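import Literature.NumberTheory.GaloisRepresentations.ContinuousCupProduct
import Literature.NumberTheory.GaloisRepresentations.LocalGlobalCohomologyFiniteProofs
import Literature.NumberTheory.GaloisRepresentations.AbsGaloisGroupCompact
import HarnessLib

/-!
# The local Tate pairing `H¹(K_v, M) × H¹(K_v, M^∨(1)) → H²(K_v, μₙ)`

Third sibling file of `Literature/NumberTheory/GaloisRepresentations/LocalGlobalCohomology.lean`
towards its named fact `exists_perfectPairing_galoisCohomology_tateDual` (local Tate duality:
Milne, *Arithmetic Duality Theorems*, I Cor. 2.3; Serre, *Cohomologie galoisienne*, II §5.2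
Thm. 2), after `LocalGlobalCohomologyDualityProofs.lean` (duality of finite groups, reductions) and
`LocalGlobalCohomologyFiniteProofs.lean` (finiteness of `H¹(K_v, M)`).  With the cup product of
`ContinuousCupProduct.lean` it **defines the pairing of the named fact** — the cup product
`H¹(K_v, M) × H¹(K_v, M^∨(1)) → H²(K_v, μₙ)` for the evaluation pairing `M × Hom(M, μₙ) → μₙ`
("cup-product defines isomorphisms `Hʳ(G, M^D) → H^{2-r}(G, M)^*`", Milne loc. cit.) — and
reduces the fact to the remaining assertion of the source: there is `inv : H²(K_v, μₙ) → ℤ/n`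
(in the source the invariant isomorphism of local class field theory, `H²(K, μₙ) = ℤ/nℤ`,
Serre II §5.2 Lemme 2) such that `inv(x ∪ y)` has trivial left and right kernels
(`exists_perfectPairing_galoisCohomology_tateDual_of_cupProduct`).  Everything here is a
definition with a body or a proved theorem; no named facts are introduced.

## Main definitions and results

* `DiscreteGaloisModule.pairing` — a `Γ_K`-equivariant bi-additive map of discrete Galois modules
  as a `ContPairing` of the underlying topological representations.
* `DiscreteGaloisModule.tateDualEval`, `tateDualEval_smul`, `tateDualPairing` — the evaluation
  `M × M^∨(1) → μₙ`, `(m, f) ↦ f m`, and its equivariance `(σf)(σm) = σ(f m)`.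
* `DiscreteGaloisModule.tateDualPairingLocal`, `DiscreteGaloisModule.localTatePairing ρ n v` —
  the pairing of the local modules at a place `v` and **the local Tate pairing**
  `H¹(K_v, M) →+ H¹(K_v, M^∨(1)) →+ H²(K_v, μₙ)` (cup product on the continuous cohomology of
  `Γ_{K_v}`, coefficients `μₙ(K̄)` restricted to `Γ_{K_v}`); `localTatePairing_oneCocycleClass`:
  on crossed homomorphisms it is the class of `(x, y, z) ↦ (g z - g y)(f y - f x)`.
* `DiscreteGaloisModule.localTatePairingZMod ρ n v inv` — `(x, y) ↦ inv (x ∪ y)` for an additive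
  `inv : H²(K_v, μₙ) → ℤ/n`; `exists_perfectPairing_galoisCohomology_tateDual_of_cupProduct`
  (resp. `…_of_cupProduct_bijective`) — the named fact follows from the injectivity of both
  adjoints of `localTatePairingZMod ρ n v inv` (resp. the bijectivity of Milne's
  `α¹ : y ↦ (x ↦ inv (x ∪ y))`) for some `inv`.

## References

* J. S. Milne, *Arithmetic Duality Theorems*, 2nd ed. (2006), Ch. I §0 (pairings, `M^D`), §2
  Cor. 2.3 (p. 28). [MilneADT2006]
* J.-P. Serre, *Cohomologie galoisienne* (5e éd.) / *Galois Cohomology* (1997), II §5.2, Lemme 2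
  and Thm. 2. [SerreGaloisCohomology1997]
* J. Neukirch, A. Schmidt, K. Wingberg, *Cohomology of Number Fields* (2008), I §4 (cup
  products), VII §2 (local duality). [NeukirchSchmidtWingberg2008]
-/

noncomputable section

open CategoryTheory Function Field NumberField IsDedekindDomain

universe u

namespace Literature.NumberTheory.GaloisRepresentations

open Literature.NumberTheory.GaloisRepresentations.DiscreteGaloisModule (mu MuCarrier mu_apply_apply)

/-! ## The local Tate pairing -/

namespace DiscreteGaloisModule

section Pairing

variable {K : Type u} [Field K] {M N P : Type u} [AddCommGroup M] [TopologicalSpace M]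
  [DiscreteTopology M] [AddCommGroup N] [TopologicalSpace N] [DiscreteTopology N]
  [AddCommGroup P] [TopologicalSpace P] [DiscreteTopology P]

/-- A `Γ_K`-equivariant bi-additive map `B : M × N → P` of discrete Galois modules as a continuous
pairing of the underlying topological representations (continuity is automatic, the modules being
discrete).  Ref: Milne, *Arithmetic Duality Theorems* (2006), Ch. I §0 (pairings of `G`-modules).
[folklore] -/
def pairing (ρM : DiscreteGaloisModule K M) (ρN : DiscreteGaloisModule K N)
    (ρP : DiscreteGaloisModule K P) (B : M →+ N →+ P)
    (hB : ∀ (σ : absoluteGaloisGroup K) (m : M) (n : N), B (ρM σ m) (ρN σ n) = ρP σ (B m n)) :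
    ContPairing ρM.toTopRep ρN.toTopRep ρP.toTopRep :=
  ContPairing.ofDiscrete
    (LinearMap.mk₂ ℤ (fun m n => B m n) (fun m m' n => by rw [map_add, AddMonoidHom.add_apply])
      (fun c m n => by
        change B.flip n (c • m) = c • B.flip n m
        rw [map_zsmul])
      (fun m n n' => map_add _ _ _) (fun c m n => map_zsmul _ _ _))
    hB

/-- Unfolding `pairing`. [folklore] -/
@[simp] theorem pairing_toLin_apply (ρM : DiscreteGaloisModule K M) (ρN : DiscreteGaloisModule K N)
    (ρP : DiscreteGaloisModule K P) (B : M →+ N →+ P)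
    (hB : ∀ (σ : absoluteGaloisGroup K) (m : M) (n : N), B (ρM σ m) (ρN σ n) = ρP σ (B m n))
    (m : M) (n : N) : (pairing ρM ρN ρP B hB).toLin m n = B m n := rfl

end Pairing

section TateDual

variable {K : Type u} [Field K] {M : Type u} [AddCommGroup M] [TopologicalSpace M]
  [DiscreteTopology M] [Finite M]

/-- The evaluation `M × Hom(M, μₙ) → μₙ`, `(m, f) ↦ f m`, as a bi-additive map. [folklore] -/
def tateDualEval (K : Type u) [Field K] (M : Type u) [AddCommGroup M] (n : ℕ) :
    M →+ TateDual K M n →+ MuCarrier K n where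
  toFun m :=
    { toFun := fun f => f m
      map_zero' := rfl
      map_add' := fun _ _ => rfl }
  map_zero' := AddMonoidHom.ext fun f => map_zero f
  map_add' m m' := AddMonoidHom.ext fun f => map_add f m m'

omit [TopologicalSpace M] [DiscreteTopology M] [Finite M] in
/-- Unfolding `tateDualEval`. [folklore] -/
@[simp] theorem tateDualEval_apply (n : ℕ) (m : M) (f : TateDual K M n) :
    tateDualEval K M n m f = f m := rfl

/-- **The evaluation pairing `M × M^∨(1) → μₙ` is `Γ_K`-equivariant**: `(σf)(σm) = σ(f m)`
(`(σf)(m') = σ f(σ⁻¹ m')`). Ref: Milne, *Arithmetic Duality Theorems* (2006), Ch. I §0, §2.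
[folklore] -/
theorem tateDualEval_smul (ρ : DiscreteGaloisModule K M) (n : ℕ) (σ : absoluteGaloisGroup K)
    (m : M) (f : TateDual K M n) :
    tateDualEval K M n (ρ σ m) (ρ.tateDual n σ f) = mu K n σ (tateDualEval K M n m f) := by
  rw [tateDualEval_apply, tateDualEval_apply, tateDual_apply_apply_apply, ← Module.End.mul_apply,
    ← map_mul, inv_mul_cancel, map_one, Module.End.one_apply]

/-- **The pairing `M × M^∨(1) → μₙ` of local Tate duality** (evaluation), as a continuous
equivariant pairing of the discrete `Γ_K`-modules `ρ`, `ρ.tateDual n`, `μₙ`.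
Ref: Milne, *Arithmetic Duality Theorems* (2006), Ch. I Cor. 2.3 (`M^D = Hom(M, μ)` paired with
`M`). [folklore] -/
def tateDualPairing (ρ : DiscreteGaloisModule K M) (n : ℕ) :
    ContPairing ρ.toTopRep (ρ.tateDual n).toTopRep (mu K n).toTopRep :=
  pairing ρ (ρ.tateDual n) (mu K n) (tateDualEval K M n) (tateDualEval_smul ρ n)

end TateDual

section Local

variable {K : Type u} [Field K] [NumberField K] {M : Type u} [AddCommGroup M] [TopologicalSpace M]
  [DiscreteTopology M] [Finite M]

attribute [local instance] absoluteGaloisGroup_compactSpace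

/-- The evaluation pairing of the **local** modules `M|_{Γ_{K_v}} × M^∨(1)|_{Γ_{K_v}} → μₙ|_{Γ_{K_v}}`
at a place `v` (restriction of `tateDualPairing` along `Γ_{K_v} → Γ_K`).
Ref: Milne, *Arithmetic Duality Theorems* (2006), Ch. I Cor. 2.3. [folklore] -/
def tateDualPairingLocal (ρ : DiscreteGaloisModule K M) (n : ℕ) (v : Place K) :
    ContPairing (ρ.toLocal v).toTopRep ((ρ.tateDual n).toLocal v).toTopRep
      ((mu K n).toLocal v).toTopRep :=
  pairing (ρ.toLocal v) ((ρ.tateDual n).toLocal v) ((mu K n).toLocal v) (tateDualEval K M n)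
    fun _ m f => tateDualEval_smul ρ n _ m f

/-- **The local Tate pairing** `H¹(K_v, M) × H¹(K_v, M^∨(1)) → H²(K_v, μₙ)` at a place `v` of a
number field: the cup product (`ContPairing.cupProduct`) for the evaluation pairing
`M × M^∨(1) → μₙ`, on the continuous cohomology of `Γ_{K_v}` (coefficients `μₙ(K̄)` restricted to
`Γ_{K_v}`).  Local Tate duality (Milne, *ADT*, I Cor. 2.3) asserts that, composed with the
invariant isomorphism `H²(K_v, μₙ) ≅ ℤ/n` of local class field theory, it is a perfect pairing of
finite groups for finite places `v`; see
`exists_perfectPairing_galoisCohomology_tateDual_of_cupProduct`.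
Ref: Milne, *Arithmetic Duality Theorems* (2006), Ch. I Cor. 2.3; Serre, *Cohomologie
galoisienne*, II §5.2 Thm. 2. [cite: MilneADT2006, Ch. I, Cor. 2.3] -/
def localTatePairing (ρ : DiscreteGaloisModule K M) (n : ℕ) (v : Place K) :
    galoisCohomology (ρ.toLocal v) 1 →+ galoisCohomology ((ρ.tateDual n).toLocal v) 1 →+
      galoisCohomology ((mu K n).toLocal v) 2 where
  toFun x := ((tateDualPairingLocal ρ n v).cupProduct x).toAddMonoidHom
  map_zero' := AddMonoidHom.ext fun y =>
    DFunLike.congr_fun (map_zero (tateDualPairingLocal ρ n v).cupProduct) y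
  map_add' x x' := AddMonoidHom.ext fun y =>
    DFunLike.congr_fun (map_add (tateDualPairingLocal ρ n v).cupProduct x x') y

/-- The local Tate pairing on classes of continuous crossed homomorphisms `f : Γ_{K_v} → M`,
`g : Γ_{K_v} → M^∨(1)`: `[f] ∪ [g]` is the class of the `2`-cocycle
`(x, y, z) ↦ (g z - g y)(f y - f x) ∈ μₙ`. [folklore] -/
theorem localTatePairing_oneCocycleClass (ρ : DiscreteGaloisModule K M) (n : ℕ) (v : Place K)
    (f : contOneCocycles (ρ.toLocal v).toTopRep)
    (g : contOneCocycles ((ρ.tateDual n).toLocal v).toTopRep) :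
    localTatePairing ρ n v (oneCocycleClass _ f) (oneCocycleClass _ g) =
      (tateDualPairingLocal ρ n v).cupClass f g := by
  rw [← ContPairing.cupProduct_oneCocycleClass]
  rfl

end Local

end DiscreteGaloisModule

/-! ### The named fact, reduced to the non-degeneracy of the cup product -/

section Reduction

variable {K : Type u} [Field K] [NumberField K] {M : Type u} [AddCommGroup M] [TopologicalSpace M]
  [DiscreteTopology M]

/-- The local Tate pairing followed by an additive map `inv : H²(K_v, μₙ) → ℤ/n` (in the source:
the invariant isomorphism of local class field theory), as a bi-additive pairing
`H¹(K_v, M) × H¹(K_v, M^∨(1)) → ℤ/n` — the shape of the pairing in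
`exists_perfectPairing_galoisCohomology_tateDual`. [folklore] -/
def DiscreteGaloisModule.localTatePairingZMod [Finite M] (ρ : DiscreteGaloisModule K M) (n : ℕ)
    (v : Place K) (inv : galoisCohomology ((mu K n).toLocal v) 2 →+ ZMod n) :
    galoisCohomology (ρ.toLocal v) 1 →+ galoisCohomology ((ρ.tateDual n).toLocal v) 1 →+ ZMod n where
  toFun x := inv.comp (DiscreteGaloisModule.localTatePairing ρ n v x)
  map_zero' := by ext y; simp
  map_add' x x' := by ext y; simp

/-- Unfolding `localTatePairingZMod`: `(x, y) ↦ inv (x ∪ y)`. [folklore] -/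
@[simp] theorem DiscreteGaloisModule.localTatePairingZMod_apply [Finite M]
    (ρ : DiscreteGaloisModule K M) (n : ℕ) (v : Place K)
    (inv : galoisCohomology ((mu K n).toLocal v) 2 →+ ZMod n)
    (x : galoisCohomology (ρ.toLocal v) 1) (y : galoisCohomology ((ρ.tateDual n).toLocal v) 1) :
    DiscreteGaloisModule.localTatePairingZMod ρ n v inv x y =
      inv (DiscreteGaloisModule.localTatePairing ρ n v x y) := rfl

/-- **Local Tate duality from the non-degeneracy of the cup product.**  Suppose that for every
finite `n`-torsion discrete `Γ_K`-module `M` (`n ≠ 0`) and every finite place `v` there is an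
additive map `inv : H²(K_v, μₙ) → ℤ/n` (in the source: the invariant isomorphism of local class
field theory, `H²(K_v, μₙ) = ℤ/nℤ`, Serre II §5.2 Lemme 2) such that the pairing
`(x, y) ↦ inv (x ∪ y)` (`DiscreteGaloisModule.localTatePairingZMod`) has both adjoints injective
(trivial left and right kernels).  Then `exists_perfectPairing_galoisCohomology_tateDual` holds:
both groups are finite (`finite_galoisCohomology_one_toLocal`,
`finite_galoisCohomology_one_tateDual_toLocal`), so trivial kernels mean perfectness
(`exists_perfectPairing_galoisCohomology_tateDual_of_exists_injective`).  This isolates what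
remains of Milne, *ADT*, I Cor. 2.3 to be proved: the computation `H²(K_v, μₙ) ≅ ℤ/n` and the
non-degeneracy of the cup product.
Ref: Milne, *Arithmetic Duality Theorems* (2006), Ch. I, Cor. 2.3; Serre, *Cohomologie
galoisienne*, II §5.2, Lemme 2 and Thm. 2. [cite: MilneADT2006, Ch. I, Cor. 2.3] -/
theorem exists_perfectPairing_galoisCohomology_tateDual_of_cupProduct
    (h : ∀ [Finite M] (ρ : DiscreteGaloisModule K M) (n : ℕ) [NeZero n], (∀ m : M, n • m = 0) →
      ∀ v : HeightOneSpectrum (𝓞 K),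
        ∃ inv : galoisCohomology ((mu K n).toLocal (Sum.inr v)) 2 →+ ZMod n,
          Injective (DiscreteGaloisModule.localTatePairingZMod ρ n (Sum.inr v) inv) ∧
          Injective (DiscreteGaloisModule.localTatePairingZMod ρ n (Sum.inr v) inv).flip) :
    exists_perfectPairing_galoisCohomology_tateDual (K := K) (M := M) :=
  exists_perfectPairing_galoisCohomology_tateDual_of_exists_injective fun ρ n _ hM v =>
    let ⟨inv, h₁, h₂⟩ := h ρ n hM v
    ⟨DiscreteGaloisModule.localTatePairingZMod ρ n (Sum.inr v) inv, h₁, h₂⟩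

/-- **Local Tate duality from Milne's isomorphism `α¹`.**  Variant in the printed form: if for all
data there is an additive `inv : H²(K_v, μₙ) → ℤ/n` such that
`y ↦ (x ↦ inv (x ∪ y)) : H¹(K_v, M^∨(1)) → Hom(H¹(K_v, M), ℤ/n) = H¹(K_v, M)^*` is bijective
("cup-product defines isomorphisms `H¹(G, M^D) → H¹(G, M)^*`", Milne, *ADT*, I Cor. 2.3, `r = 1`;
`H¹(G, M)^* = Hom(H¹(G, M), ℚ/ℤ) = Hom(H¹(G, M), ℤ/n)` as `n · H¹(G, M) = 0`), then
`exists_perfectPairing_galoisCohomology_tateDual` holds (`H¹(K_v, M)` being finite,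
`exists_perfectPairing_galoisCohomology_tateDual_of_exists_bijective_flip`).
Ref: Milne, *Arithmetic Duality Theorems* (2006), Ch. I, Cor. 2.3. [cite: MilneADT2006, Ch. I, Cor. 2.3] -/
theorem exists_perfectPairing_galoisCohomology_tateDual_of_cupProduct_bijective
    (h : ∀ [Finite M] (ρ : DiscreteGaloisModule K M) (n : ℕ) [NeZero n], (∀ m : M, n • m = 0) →
      ∀ v : HeightOneSpectrum (𝓞 K),
        ∃ inv : galoisCohomology ((mu K n).toLocal (Sum.inr v)) 2 →+ ZMod n,
          Bijective (DiscreteGaloisModule.localTatePairingZMod ρ n (Sum.inr v) inv).flip) :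
    exists_perfectPairing_galoisCohomology_tateDual (K := K) (M := M) :=
  exists_perfectPairing_galoisCohomology_tateDual_of_exists_bijective_flip fun ρ n _ hM v =>
    let ⟨inv, hinv⟩ := h ρ n hM v
    ⟨DiscreteGaloisModule.localTatePairingZMod ρ n (Sum.inr v) inv, hinv⟩

end Reduction

end Literature.NumberTheory.GaloisRepresentations

end
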